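import Summits.BirchSwinnertonDyer.BirchSwinnertonDyer.Theses.PrintX9
import Summits.BirchSwinnertonDyer.BirchSwinnertonDyer.Theorems.PrintX9HeegnerDivisibility
import Summits.BirchSwinnertonDyer.BirchSwinnertonDyer.Theorems.PrintX9GreenbergMuBridge
import HarnessLib

/-!
# Route PrintX9 — the GREENBERG ROAD in the route's currency: the leaf `Rank1Residual.BSDpOnClassX9`
# from crux J (`HeegnerDivisibilityX9`, 20392) + the ALGEBRAIC `μ = 0` on class X9 + the two print
# bundles, with NO Kato μ-transfer (19629 / F1) and NO analytic `μ` crux (19630)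

Cell `bsd-print-x9` (D-0131 (2) PRINT tier, leaves ClassX9 + ClassX10b), seat `bsd-print-x9-p1` (prover p1,
strategy «BCS 2024 under irreducibility by name ⇒ BSD_p r ≤ 1; discharge per class»), gen 2. Support
file of crux 19630 (`AnalyticMuZeroX9`): an ALTERNATIVE decomposition (banked) of the route's proved
Assembly (20531, p542280: `J → MuTransfer → AnalyticMuZeroX9 → HeegnerPrintFactsX9 → CyclotomicPrintFactsX9
→ leaf`), the X9 twin of `Theorems/PrintX10bGreenbergMuRoad.lean`.

HONEST FRAMING. BSD is not proved; no class is closed; nothing is booked. Rev 3 of PrintX9 reaches the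
leaf through the Kato-side μ-transfer (19629 = `KatoMuTransfer`, kernel-checked modulo Kato's package F1,
registry flag E114 ⇒ LITERAL currency) and the ANALYTIC crux 19630. The seat's gen-0 bridge
`integralMainConjectureOnClassX9_of_muZeroOnClassX9` (p536327: BCS (a) ×4 + display (5.3) + GV 3.7 + the
ALGEBRAIC `μ = 0` on class X9 ⟹ `IntegralMainConjectureOnClassX9`, NO F1, NO analytic certificate) composes
with p4's Schneider-free kernel `bsdpOnClassX9_of_heegnerDivisibilityX9_of_integralMainConjectureOnClassX9`
(p537990 §4) to

  (μX9) ∧ J ∧ `HeegnerPrintFactsX9` ∧ `CyclotomicPrintFactsX9` ∧ BCS display (5.3) ⟹ `BSDpOnClassX9`,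

where (μX9) = «for every X9 pair `(V, p)` (`Rank1Residual.ClassX9`), every cyclotomic datum `(κ, γ)` and
every dual Selmer datum `D` of `V` over `ℚ_∞`, `μ(D) = 0`» (Greenberg's Conjecture 1.11, ALGEBRAIC side,
on class X9; spelled inline, the cell's `hμ` shape). So on this road the cruxes are {J (20392), (μX9)} and
the asides are rev 3's + ONE more print fact (BCS (5.3), `display53_prod_charIdeal_le_prod_padicLFunction`,
p532868, flag `BCS composite`); NO F1 / E114. (μX9) ⟹ 19630 modulo the same print
(`printX9_analyticMuZeroX9_of_muZeroOnClassX9`); conversely 19629 ∧ 19630 ⟹ (μX9)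
(`Rank1Residual.mu_eq_zero_of_katoMuTransfer_of_analyticMuZero`, tree) — so the two roads' residual
μ-cruxes coincide modulo print and F1 (p542523).

beyond-print theorem: no. Flags riding on this road: BCS composite (hBCS, h53, h124a), Cha05-Rmk25.

References: [GreenbergLNM1716] §1 Conj. 1.11, Thm. 4.1; [BurungaleCastellaSkinner2025] Thm. 1.1.2 (a),
display (5.3), Thm. 1.2.4 (a), Prop. 4.2.2, Cor. 1.3.1; [Cha2005] Rmk. 25; [Jetchev2008] Conj. 1.3;
[MatarNekovar2019] Prop. 5.26 (2); [JetchevSkinnerWan2017] Thm. 3.3.1; [Miller2011LMS] Def. 1.1.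
-/

set_option autoImplicit false

noncomputable section

open scoped Classical

open WeierstrassCurve Literature.NumberTheory.GaloisRepresentations
open Literature.NumberTheory.EllipticCurves Literature.NumberTheory.EllipticCurves.ModularForms
open Literature.NumberTheory.EllipticCurves.BurungaleCastellaSkinner2025
  (display53_prod_charIdeal_le_prod_padicLFunction)
open Summit.BirchSwinnertonDyer.BirchSwinnertonDyer.Theses
open Summit.BirchSwinnertonDyer.BirchSwinnertonDyer.Rank1Residual (ClassX9 BSDpOnClassX9
  bsdpOnClassX9_of_heegnerDivisibilityX9_of_integralMainConjectureOnClassX9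
  integralMainConjectureOnClassX9_of_muZeroOnClassX9 integralMainConjectureOnClassX9_of_greenbergMuConjectureIrreducible
  analyticMuZeroOnClassX9_of_muZeroOnClassX9)

namespace Summit.BirchSwinnertonDyer.Rank1Residual.X9

/-- **The X9 leaf on the GREENBERG ROAD, in route PrintX9's currency.** Hypotheses: (μX9) = the
ALGEBRAIC `μ = 0` on class X9 (inline), BCS display (5.3) (`h53`, named fact p532868), crux J
(`Theses.PrintX9.HeegnerDivisibilityX9`, 20392) and the route's two print bundles
`HeegnerPrintFactsX9` (20530) and `CyclotomicPrintFactsX9` (20532). NOT used: `MuTransfer` (19629, F1)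
and `AnalyticMuZeroX9` (19630). Proof: destructure the bundles; p4's
`bsdpOnClassX9_of_heegnerDivisibilityX9_of_integralMainConjectureOnClassX9` with the K6 rank-`0` engine
`IntegralMainConjectureOnClassX9` supplied by the seat's `integralMainConjectureOnClassX9_of_muZeroOnClassX9`.
CONDITIONAL on (μX9) and J; flags BCS composite / Cha05-Rmk25 ride; nothing booked.
[cite: GreenbergLNM1716, §1 Conj. 1.11] [cite: BurungaleCastellaSkinner2025, Thm. 1.1.2 (a), display (5.3), Cor. 1.3.1]
[cite: Cha2005, Rmk. 25 (p. 175)] [cite: Miller2011LMS, §1 and Def. 1.1] -/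
theorem printX9_bsdpOnClassX9_of_heegnerDivisibilityX9_of_muZeroOnClassX9
    (hμX9 : ∀ (V : WeierstrassCurve ℚ) [V.IsElliptic] [V.IsGloballyMinimal] (p : ℕ) [Fact p.Prime],
      ClassX9 V p → ∀ (κ : ZpExtension ℚ p) (γ : Field.absoluteGaloisGroup ℚ),
        κ.IsCyclotomic → κ.IsTopGenerator γ → IsCyclotomicVariable p γ →
        ∀ D : V.SelmerDualData κ γ, D.mu = 0)
    (h53 : display53_prod_charIdeal_le_prod_padicLFunction)
    (hJ : PrintX9.HeegnerDivisibilityX9) (hHP : PrintX9.HeegnerPrintFactsX9)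
    (hCP : PrintX9.CyclotomicPrintFactsX9) : BSDpOnClassX9 := by
  obtain ⟨hGZ, hKo, hrec, hD36, hChaU, h526, h124a, h331, hnf, hHL, hMaz, hNS⟩ := hHP
  obtain ⟨hBCS, hGr, hGZK, hmod, hpar, h5⟩ := hCP
  exact bsdpOnClassX9_of_heegnerDivisibilityX9_of_integralMainConjectureOnClassX9 hGZ hKo hrec hD36 hChaU
    h526 h124a h331 hGr hGZK hmod hpar hnf hHL hMaz hNS h5 hJ
    (integralMainConjectureOnClassX9_of_muZeroOnClassX9 hμX9 hBCS h53 hnf h5)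

/-- **The same road from Greenberg's Conjecture 1.11 (irreducible form, the typed leaf
`Rank1Residual.GreenbergMuConjectureIrreducible`)** in place of (μX9): J ∧ Greenberg ∧ the two print
bundles ∧ BCS (5.3) ⟹ `BSDpOnClassX9`. CONDITIONAL; nothing booked.
[cite: GreenbergLNM1716, §1 Conj. 1.11] [cite: BurungaleCastellaSkinner2025, Thm. 1.1.2 (a), display (5.3), Cor. 1.3.1] -/
theorem printX9_bsdpOnClassX9_of_heegnerDivisibilityX9_of_greenbergMuConjectureIrreducible
    (hGrμ : Summit.BirchSwinnertonDyer.Rank1Residual.GreenbergMuConjectureIrreducible)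
    (h53 : display53_prod_charIdeal_le_prod_padicLFunction)
    (hJ : PrintX9.HeegnerDivisibilityX9) (hHP : PrintX9.HeegnerPrintFactsX9)
    (hCP : PrintX9.CyclotomicPrintFactsX9) : BSDpOnClassX9 := by
  obtain ⟨hGZ, hKo, hrec, hD36, hChaU, h526, h124a, h331, hnf, hHL, hMaz, hNS⟩ := hHP
  obtain ⟨hBCS, hGr, hGZK, hmod, hpar, h5⟩ := hCP
  exact bsdpOnClassX9_of_heegnerDivisibilityX9_of_integralMainConjectureOnClassX9 hGZ hKo hrec hD36 hChaU
    h526 h124a h331 hGr hGZK hmod hpar hnf hHL hMaz hNS h5 hJ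
    (integralMainConjectureOnClassX9_of_greenbergMuConjectureIrreducible hGrμ hBCS h53 hnf h5)

/-- **Crux 19630 (`AnalyticMuZeroX9`) from the ALGEBRAIC `μ = 0` on class X9, in the route's currency.**
(μX9) + the cyclotomic print bundle `CyclotomicPrintFactsX9` (its conjuncts BCS (a) `hBCS` and the period
unit `h5` are used) + BCS (5.3) + modularity as a newform (`hnf`, conjunct 9 of `HeegnerPrintFactsX9`;
taken as a separate binder here) ⟹ `Theses.PrintX9.AnalyticMuZeroX9` — the seat's gen-0
`analyticMuZeroOnClassX9_of_muZeroOnClassX9` read on the route declaration. CONDITIONAL; nothing booked.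
[cite: GreenbergLNM1716, §1 Conj. 1.11] [cite: BurungaleCastellaSkinner2025, Thm. 1.1.2 (a), display (5.3)]
[cite: GreenbergVatsal2000, Prop. 3.7] -/
theorem printX9_analyticMuZeroX9_of_muZeroOnClassX9
    (hμX9 : ∀ (V : WeierstrassCurve ℚ) [V.IsElliptic] [V.IsGloballyMinimal] (p : ℕ) [Fact p.Prime],
      ClassX9 V p → ∀ (κ : ZpExtension ℚ p) (γ : Field.absoluteGaloisGroup ℚ),
        κ.IsCyclotomic → κ.IsTopGenerator γ → IsCyclotomicVariable p γ →
        ∀ D : V.SelmerDualData κ γ, D.mu = 0)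
    (h53 : display53_prod_charIdeal_le_prod_padicLFunction) (hnf : exists_isNewformOf)
    (hCP : PrintX9.CyclotomicPrintFactsX9) : PrintX9.AnalyticMuZeroX9 := by
  obtain ⟨hBCS, -, -, -, -, h5⟩ := hCP
  exact analyticMuZeroOnClassX9_of_muZeroOnClassX9 hμX9 hBCS h53 hnf h5

end Summit.BirchSwinnertonDyer.Rank1Residual.X9

end
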